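import Mathlib.MeasureTheory.Integral.Gamma
import Mathlib.Analysis.SpecialFunctions.Gaussian.GaussianIntegral
import Mathlib.Analysis.SpecialFunctions.ImproperIntegrals
import Mathlib.Analysis.SpecialFunctions.Exponential
import Literature.Analysis.FunctionSpaces.BesselJProofs
import HarnessLib

/-!
# The Laplace transform of `J₀(β√x)`: `∫₀^∞ e^{-px} J₀(β√x) dx = e^{-β²/(4p)}/p`

For the Bessel function `besselJ 0` of `Literature.Analysis.FunctionSpaces.BesselJ` (power series
definition) we prove, for every `p > 0` and real `β`,

* `integral_exp_neg_mul_besselJ_zero_sqrt` —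
  `∫₀^∞ e^{-px} J₀(β√x) dx = e^{-β²/(4p)} / p`.

This is Weber's first exponential integral `∫₀^∞ e^{-p t²} J₀(βt) t dt = e^{-β²/(4p)}/(2p)`
(Watson §13.3 (1); Andrews–Askey–Roy (4.11.25)) after the substitution `x = t²`; as in loc. cit.
(and as in the tree's `integral_exp_neg_mul_sq_mul_besselJ_one` for `J₁`) it is proved by
term-wise integration of the series `J₀(β√x) = Σ_k (-1)^k (β²x/4)^k/(k!)²` against `e^{-px}`
(`∫₀^∞ x^k e^{-px} dx = k!/p^{k+1}`), the interchange being justified by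
`Σ_k ∫₀^∞ |e^{-px}(β²x/4)^k/(k!)²| dx = e^{β²/(4p)}/p < ∞`.

It is the `J₀`-inversion input of the weight-one Voronoi summation formula (Conrey–Iwaniec 2002,
Proposition 3.1, (3.11)–(3.13)) in the form used by the cell `landau-siegel/ls-inputs`
(sub-line `theta-voronoi`, stub V2): applied to the test functions `e^{-px}` the modular relation
(3.4) is *literally* the summation formula, because the Hankel-type transform of `e^{-px}` against
`J₀((4π/C)√(nx))` is `e^{-4π²n/(C²p)}/p`.

Also recorded: the elementary facts about the kernel `x ↦ J₀(β√x)` (continuity, `|·| ≤ 1`) and a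
complex-valued restatement.

## References

* G. N. Watson, *A Treatise on the Theory of Bessel Functions* (1944), §13.3 (1) (Weber's first
  exponential integral).
* G. E. Andrews, R. Askey, R. Roy, *Special Functions* (1999), §4.11 (4.11.25).
-/

noncomputable section

open scoped Topology Nat
open Filter Set MeasureTheory Real

namespace Literature.Analysis.FunctionSpaces

/-! ## The kernel `x ↦ J₀(β√x)` -/

/-- `x ↦ J₀(β√x)` is continuous on `ℝ` (`J₀` is entire). [cite: Watson1944, §2.11] -/
theorem continuous_besselJ_zero_sqrt (β : ℝ) : Continuous fun x : ℝ => besselJ 0 (β * Real.sqrt x) :=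
  (continuous_besselJ_holds 0).comp (continuous_const.mul Real.continuous_sqrt)

/-- `|J₀(β√x)| ≤ 1`. [cite: DLMF, 10.14.1] -/
theorem abs_besselJ_zero_sqrt_le_one (β x : ℝ) : |besselJ 0 (β * Real.sqrt x)| ≤ 1 :=
  abs_besselJ_zero_le_one_holds _

/-- The `k`-th term of the series of `J₀(β√x)` for `x ≥ 0`:
`(-1)^k (β√x/2)^{2k}/(k!)² = (-1)^k (β²x/4)^k/(k!)²`. [cite: Watson1944, §2.1 (8)] -/
theorem besselJTerm_zero_mul_sqrt {x : ℝ} (hx : 0 ≤ x) (β : ℝ) (k : ℕ) :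
    besselJTerm 0 (β * Real.sqrt x) k = (-1) ^ k / ((k ! : ℝ) * k !) * (β ^ 2 * x / 4) ^ k := by
  simp only [besselJTerm, add_zero]
  congr 1
  rw [pow_mul, div_pow, mul_pow, Real.sq_sqrt hx]
  ring

/-! ## The moments `∫₀^∞ x^k e^{-px} dx` -/

/-- `∫₀^∞ x^k e^{-px} dx = k!/p^{k+1}` for `p > 0` (Euler's integral `Γ(k+1) = k!`, rescaled). [cite: DLMF, 5.2.1, 5.4.1] -/
theorem integral_pow_mul_exp_neg_mul_Ioi {p : ℝ} (hp : 0 < p) (k : ℕ) :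
    ∫ x in Ioi (0 : ℝ), x ^ k * exp (-(p * x)) = k ! / p ^ (k + 1) := by
  have h := integral_rpow_mul_exp_neg_mul_rpow (p := 1) (q := k) (b := p) one_pos
    (by have := k.cast_nonneg (α := ℝ); linarith) hp
  simp only [rpow_one, div_one, mul_one] at h
  have hlhs : ∫ x in Ioi (0 : ℝ), x ^ k * exp (-(p * x)) =
      ∫ x in Ioi (0 : ℝ), x ^ (k : ℝ) * exp (-p * x) := by
    refine setIntegral_congr_fun measurableSet_Ioi fun x _ => ?_
    rw [Real.rpow_natCast, neg_mul]
  rw [hlhs, h, Real.Gamma_nat_eq_factorial, Real.rpow_neg hp.le, ← Nat.cast_succ, Real.rpow_natCast]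
  field_simp

/-- `x ↦ x^k e^{-px}` is integrable on `(0, ∞)` for `p > 0` (convergence of Euler's integral). [cite: DLMF, 5.2.1] -/
theorem integrableOn_pow_mul_exp_neg_mul_Ioi {p : ℝ} (hp : 0 < p) (k : ℕ) :
    IntegrableOn (fun x : ℝ => x ^ k * exp (-(p * x))) (Ioi 0) := by
  have h := integrableOn_rpow_mul_exp_neg_mul_rpow (s := k) (p := 1) (b := p)
    (by have := k.cast_nonneg (α := ℝ); linarith) le_rfl hp
  refine h.congr_fun (fun x _ => ?_) measurableSet_Ioi
  simp only [Real.rpow_natCast, Real.rpow_one, neg_mul]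

/-! ## Term-wise integration -/

/-- On `(0, ∞)`: `e^{-px} · [k-th term of J₀(β√x)] = [(-1)^k (β²/4)^k/(k!)²] · x^k e^{-px}`. [folklore] -/
private theorem exp_neg_mul_mul_besselJTerm_zero_sqrt {x : ℝ} (hx : 0 ≤ x) (p β : ℝ) (k : ℕ) :
    exp (-(p * x)) * besselJTerm 0 (β * Real.sqrt x) k =
      (-1) ^ k * (β ^ 2 / 4) ^ k / ((k ! : ℝ) * k !) * (x ^ k * exp (-(p * x))) := by
  rw [besselJTerm_zero_mul_sqrt hx]
  rw [show β ^ 2 * x / 4 = β ^ 2 / 4 * x by ring, mul_pow]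
  ring

/-- `∫₀^∞ e^{-px} [k-th term of J₀(β√x)] dx = (1/p) (-β²/(4p))^k / k!` for `p > 0`. [folklore] -/
private theorem integral_exp_neg_mul_mul_besselJTerm_zero_sqrt {p : ℝ} (hp : 0 < p) (β : ℝ) (k : ℕ) :
    ∫ x in Ioi (0 : ℝ), exp (-(p * x)) * besselJTerm 0 (β * Real.sqrt x) k =
      p⁻¹ * ((-(β ^ 2 / (4 * p))) ^ k / k !) := by
  rw [setIntegral_congr_fun measurableSet_Ioi
    (fun x (hx : 0 < x) => exp_neg_mul_mul_besselJTerm_zero_sqrt hx.le p β k),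
    integral_const_mul, integral_pow_mul_exp_neg_mul_Ioi hp k]
  have hk : (k ! : ℝ) ≠ 0 := by positivity
  have hp' : p ≠ 0 := hp.ne'
  rw [show -(β ^ 2 / (4 * p)) = (-1) * ((β ^ 2 / 4) / p) by ring]
  simp only [mul_pow, div_pow, pow_succ]
  field_simp

/-- The norm of the `k`-th term on `(0, ∞)`: `[(β²/4)^k/(k!)²] · x^k e^{-px}`. [folklore] -/
private theorem norm_exp_neg_mul_mul_besselJTerm_zero_sqrt {x : ℝ} (hx : 0 ≤ x) (p β : ℝ) (k : ℕ) :
    ‖exp (-(p * x)) * besselJTerm 0 (β * Real.sqrt x) k‖ =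
      (β ^ 2 / 4) ^ k / ((k ! : ℝ) * k !) * (x ^ k * exp (-(p * x))) := by
  rw [exp_neg_mul_mul_besselJTerm_zero_sqrt hx, norm_mul, norm_div, norm_mul, norm_pow, norm_neg,
    norm_one, one_pow, one_mul, norm_pow,
    Real.norm_of_nonneg (by positivity : (0 : ℝ) ≤ β ^ 2 / 4),
    Real.norm_of_nonneg (by positivity : (0 : ℝ) ≤ (k ! : ℝ) * k !),
    Real.norm_of_nonneg (by positivity : (0 : ℝ) ≤ x ^ k * exp (-(p * x)))]

/-- Each term `e^{-px} [k-th term of J₀(β√x)]` is integrable on `(0, ∞)` for `p > 0`. [folklore] -/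
private theorem integrableOn_exp_neg_mul_mul_besselJTerm_zero_sqrt {p : ℝ} (hp : 0 < p) (β : ℝ) (k : ℕ) :
    IntegrableOn (fun x : ℝ => exp (-(p * x)) * besselJTerm 0 (β * Real.sqrt x) k) (Ioi 0) := by
  have h : IntegrableOn (fun x : ℝ => (-1) ^ k * (β ^ 2 / 4) ^ k / ((k ! : ℝ) * k !) *
      (x ^ k * exp (-(p * x)))) (Ioi 0) :=
    (integrableOn_pow_mul_exp_neg_mul_Ioi hp k).const_mul _
  refine h.congr_fun (fun x (hx : 0 < x) => ?_) measurableSet_Ioi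
  exact (exp_neg_mul_mul_besselJTerm_zero_sqrt hx.le p β k).symm

/-- `∫₀^∞ ‖e^{-px} [k-th term of J₀(β√x)]‖ dx = (1/p) (β²/(4p))^k / k!` for `p > 0`. [folklore] -/
private theorem integral_norm_exp_neg_mul_mul_besselJTerm_zero_sqrt {p : ℝ} (hp : 0 < p) (β : ℝ) (k : ℕ) :
    ∫ x in Ioi (0 : ℝ), ‖exp (-(p * x)) * besselJTerm 0 (β * Real.sqrt x) k‖ =
      p⁻¹ * ((β ^ 2 / (4 * p)) ^ k / k !) := by
  rw [setIntegral_congr_fun measurableSet_Ioi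
    (fun x (hx : 0 < x) => norm_exp_neg_mul_mul_besselJTerm_zero_sqrt hx.le p β k),
    integral_const_mul, integral_pow_mul_exp_neg_mul_Ioi hp k]
  have hk : (k ! : ℝ) ≠ 0 := by positivity
  have hp' : p ≠ 0 := hp.ne'
  rw [show β ^ 2 / (4 * p) = (β ^ 2 / 4) / p by ring]
  simp only [div_pow, pow_succ]
  field_simp

/-- **The Laplace transform of `J₀(β√x)`** (Weber's first exponential integral after `x = t²`):
`∫₀^∞ e^{-px} J₀(β√x) dx = e^{-β²/(4p)}/p` for `p > 0` and real `β`, by term-wise integration of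
the Bessel series. [cite: Watson1944, §13.3 (1)] -/
theorem integral_exp_neg_mul_besselJ_zero_sqrt {p : ℝ} (hp : 0 < p) (β : ℝ) :
    ∫ x in Ioi (0 : ℝ), exp (-(p * x)) * besselJ 0 (β * Real.sqrt x) =
      exp (-(β ^ 2 / (4 * p))) / p := by
  have hint : ∀ k, Integrable (fun x : ℝ => exp (-(p * x)) * besselJTerm 0 (β * Real.sqrt x) k)
      (volume.restrict (Ioi 0)) :=
    fun k => integrableOn_exp_neg_mul_mul_besselJTerm_zero_sqrt hp β k
  have hsum : Summable fun k =>
      ∫ x in Ioi (0 : ℝ), ‖exp (-(p * x)) * besselJTerm 0 (β * Real.sqrt x) k‖ := by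
    simp_rw [integral_norm_exp_neg_mul_mul_besselJTerm_zero_sqrt hp]
    exact (Real.summable_pow_div_factorial (β ^ 2 / (4 * p))).mul_left _
  have hswap := integral_tsum_of_summable_integral_norm hint hsum
  have htsum : ∀ x : ℝ, ∑' k, exp (-(p * x)) * besselJTerm 0 (β * Real.sqrt x) k =
      exp (-(p * x)) * besselJ 0 (β * Real.sqrt x) :=
    fun x => ((hasSum_besselJ_holds 0 (β * Real.sqrt x)).mul_left _).tsum_eq
  simp_rw [htsum, integral_exp_neg_mul_mul_besselJTerm_zero_sqrt hp] at hswap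
  rw [← hswap, tsum_mul_left]
  have hexp : HasSum (fun k : ℕ => (-(β ^ 2 / (4 * p))) ^ k / (k ! : ℝ)) (exp (-(β ^ 2 / (4 * p)))) := by
    rw [Real.exp_eq_exp_ℝ]
    exact NormedSpace.expSeries_div_hasSum_exp (-(β ^ 2 / (4 * p)))
  rw [hexp.tsum_eq, inv_mul_eq_div]

/-- `e^{-px} J₀(β√x)` is integrable on `(0, ∞)` for `p > 0` (absolute convergence of Weber's integral). [cite: Watson1944, §13.3 (1)] -/
theorem integrableOn_exp_neg_mul_besselJ_zero_sqrt {p : ℝ} (hp : 0 < p) (β : ℝ) :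
    IntegrableOn (fun x : ℝ => exp (-(p * x)) * besselJ 0 (β * Real.sqrt x)) (Ioi 0) := by
  have h1 : IntegrableOn (fun x : ℝ => exp (-(p * x))) (Ioi 0) := by
    have h := exp_neg_integrableOn_Ioi 0 hp
    simpa only [neg_mul] using h
  refine Integrable.mul_of_top_left h1 ?_
  refine memLp_top_of_bound ((continuous_besselJ_zero_sqrt β).aestronglyMeasurable) 1 ?_
  exact Filter.Eventually.of_forall fun x => by
    rw [Real.norm_eq_abs]; exact abs_besselJ_zero_sqrt_le_one β x

/-- **Complex-valued form** of `integral_exp_neg_mul_besselJ_zero_sqrt`: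
`∫₀^∞ e^{-px} J₀(β√x) dx = e^{-β²/(4p)}/p` with the integrand coerced to `ℂ`. [cite: Watson1944, §13.3 (1)] -/
theorem integral_exp_neg_mul_besselJ_zero_sqrt_complex {p : ℝ} (hp : 0 < p) (β : ℝ) :
    ∫ x in Ioi (0 : ℝ), ((exp (-(p * x)) : ℝ) : ℂ) * ((besselJ 0 (β * Real.sqrt x) : ℝ) : ℂ) =
      ((exp (-(β ^ 2 / (4 * p))) / p : ℝ) : ℂ) := by
  rw [← integral_exp_neg_mul_besselJ_zero_sqrt hp β, ← integral_complex_ofReal]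
  simp only [Complex.ofReal_mul]

end Literature.Analysis.FunctionSpaces

end
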